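import Summits.CriticalPhenomena.SAWScalingLimit.Theorems.SAWDefectDecoherenceObservableToSLERTwoPieceAdmIdentificationMesh
import HarnessLib

/-!
# Crux `SAWDefectDecoherence.ObservableToSLER` (stmt-CriticalPhenomena-14005), line
`bridge-gate-renewal` (r7), stub 5a3 `stub_twoPieceAdmIdentification`: the admissibility clauses
of the sub-family at a good mesh

Landing target:
`Summits/CriticalPhenomena/SAWScalingLimit/Theorems/SAWDefectDecoherenceObservableToSLERTwoPieceAdmIdentificationClauses.lean`
(`--supports stmt-CriticalPhenomena-14005`).  Sequel of `…TwoPieceAdmIdentificationMesh`.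

`subFamily_clauses`: at a mesh `δ` which is small against the flat scale `L` (`16δ ≤ L`,
`4L ≤ ρ`), for a vertex family `Λ` of the two-piece flat domain `M` which is the exact rows
`≥ m₀`, `≥ m₁` in the flat balls, with boundary mid-edges `a ≠ b` whose inner ends are within
`L/8` of the marked points, floor rows of height `≤ Im pt i + L/2`, an exclusion set `T` staying
`4L` away from the marked points, containing `M ∖ M'` and escapable to the floor at `pt 1`
(`…Component`), and ONE lattice link from the source to a hub vertex at `pt 1`, the sub-family
`Λ'` (component of the inner end of `a` in the deep vertices) satisfies every fixed-mesh clause of the two-piece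
admissible restriction limit: `Λ' ⊆ Λ`, simply connected, connected, `a, b` boundary mid-edges
of `Λ'`, a walk `a → b` in `Λ'`, rescaled centres in `M'`, exact rows `≥ m₀`, `≥ m₁` in the balls
of radius `L/8`; and the hub vertices at `pt 0` belong to `Λ'`.
-/

noncomputable section

open scoped Topology Classical
open Filter Set Metric
open Literature.Probability.LatticeModels (HexVertex hexGraph hexCenter Site polyline)
open Literature.Probability.RandomPlanarGeometry
open Literature.Probability.RandomPlanarGeometry.SAW
open Literature.Probability.Percolation (PathIn)

namespace Summit.CriticalPhenomena.SAWScalingLimit.Theorems.ObservableToSLER.TwoPiece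

open Summit.CriticalPhenomena.SAWScalingLimit.Theorems.ObservableToSLE.FloorRatio

/-- **THE CLAUSES OF THE SUB-FAMILY AT A GOOD MESH** (see the module docstring for the list of
hypotheses and conclusions; the sub-family is the component of the inner end `v_a` of `a` in the
deep vertices `{u ∈ Λ | dist(δ c_u, T) > 6δ}`, written out as a `Finset.filter`).
[cite: DuminilCopinSmirnov2012, §2 (domains) and §4 (before Conjecture 1)] -/
theorem subFamily_clauses {M M' : Set ℂ} {p₀ p₁ : ℂ} {ρ L δ : ℝ} {Λ : Finset HexVertex}
    {m₀ m₁ : ℤ} {a b : Sym2 HexVertex} {T : Set ℂ} {ua va ub vb : HexVertex}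
    (hδ : 0 < δ) (hδL : 16 * δ ≤ L) (hLρ : 4 * L ≤ ρ)
    (hflat₁ : M ∩ ball p₁ ρ = {z : ℂ | p₁.im < z.im} ∩ ball p₁ ρ)
    (hΛM : ∀ v ∈ Λ, (δ : ℂ) * hexCenter v ∈ M)
    (hrow₀ : ∀ v : HexVertex, (δ : ℂ) * hexCenter v ∈ ball p₀ ρ → (v ∈ Λ ↔ m₀ ≤ v.1 1))
    (hrow₁ : ∀ v : HexVertex, (δ : ℂ) * hexCenter v ∈ ball p₁ ρ → (v ∈ Λ ↔ m₁ ≤ v.1 1))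
    (hsc : hexDomainSimplyConnected Λ)
    (hea : a = s(ua, va)) (hvaΛ : va ∈ Λ) (huaΛ : ua ∉ Λ) (hadja : hexGraph.Adj ua va)
    (heb : b = s(ub, vb)) (hvbΛ : vb ∈ Λ) (hubΛ : ub ∉ Λ) (hadjb : hexGraph.Adj ub vb)
    (hab : a ≠ b)
    (hTfar₀ : ∀ y ∈ T, 4 * L ≤ dist y p₀) (hTfar₁ : ∀ y ∈ T, 4 * L ≤ dist y p₁)
    (hTdiff : M \ M' ⊆ T)
    (hTesc : ∀ y ∈ T, ∃ Ty ⊆ T, IsPreconnected Ty ∧ y ∈ Ty ∧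
      ∃ q ∈ Ty, q.im = p₁.im ∧ dist q p₁ < ρ / 4)
    (hva : dist ((δ : ℂ) * hexCenter va) p₀ ≤ L / 8)
    (hvb : dist ((δ : ℂ) * hexCenter vb) p₁ ≤ L / 8)
    (hH₀ : ((m₀ : ℝ) + 1 / 3) * (δ * (Real.sqrt 3 / 2)) ≤ p₀.im + L / 2)
    (hH₁ : ((m₁ : ℝ) + 1 / 3) * (δ * (Real.sqrt 3 / 2)) ≤ p₁.im + L / 2)
    (hlink : ∀ z : HexVertex, dist ((δ : ℂ) * hexCenter z) (p₁ + (L : ℂ) * Complex.I) ≤ δ →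
      PathIn hexGraph {u : HexVertex | u ∈ Λ ∧ ∀ y ∈ T, 6 * δ < dist ((δ : ℂ) * hexCenter u) y} va z) :
    (Λ.filter fun z => PathIn hexGraph {u : HexVertex | u ∈ Λ ∧ ∀ y ∈ T, 6 * δ < dist ((δ : ℂ) * hexCenter u) y} va z) ⊆ Λ ∧
    hexDomainSimplyConnected (Λ.filter fun z => PathIn hexGraph {u : HexVertex | u ∈ Λ ∧ ∀ y ∈ T, 6 * δ < dist ((δ : ℂ) * hexCenter u) y} va z) ∧
    (hexGraph.induce (↑(Λ.filter fun z => PathIn hexGraph {u : HexVertex | u ∈ Λ ∧ ∀ y ∈ T, 6 * δ < dist ((δ : ℂ) * hexCenter u) y} va z) : Set HexVertex)).Preconnected ∧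
    a ∈ hexDomainBoundary (Λ.filter fun z => PathIn hexGraph {u : HexVertex | u ∈ Λ ∧ ∀ y ∈ T, 6 * δ < dist ((δ : ℂ) * hexCenter u) y} va z) ∧
    b ∈ hexDomainBoundary (Λ.filter fun z => PathIn hexGraph {u : HexVertex | u ∈ Λ ∧ ∀ y ∈ T, 6 * δ < dist ((δ : ℂ) * hexCenter u) y} va z) ∧
    Nonempty (HexMidEdgeSAW (Λ.filter fun z => PathIn hexGraph {u : HexVertex | u ∈ Λ ∧ ∀ y ∈ T, 6 * δ < dist ((δ : ℂ) * hexCenter u) y} va z) a b) ∧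
    (∀ v ∈ (Λ.filter fun z => PathIn hexGraph {u : HexVertex | u ∈ Λ ∧ ∀ y ∈ T, 6 * δ < dist ((δ : ℂ) * hexCenter u) y} va z), (δ : ℂ) * hexCenter v ∈ M') ∧
    (∀ v : HexVertex, (δ : ℂ) * hexCenter v ∈ ball p₀ (L / 8) → (v ∈ (Λ.filter fun z => PathIn hexGraph {u : HexVertex | u ∈ Λ ∧ ∀ y ∈ T, 6 * δ < dist ((δ : ℂ) * hexCenter u) y} va z) ↔ m₀ ≤ v.1 1)) ∧
    (∀ v : HexVertex, (δ : ℂ) * hexCenter v ∈ ball p₁ (L / 8) → (v ∈ (Λ.filter fun z => PathIn hexGraph {u : HexVertex | u ∈ Λ ∧ ∀ y ∈ T, 6 * δ < dist ((δ : ℂ) * hexCenter u) y} va z) ↔ m₁ ≤ v.1 1)) ∧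
    (∀ z : HexVertex, dist ((δ : ℂ) * hexCenter z) (p₀ + (L : ℂ) * Complex.I) ≤ δ → z ∈ (Λ.filter fun z => PathIn hexGraph {u : HexVertex | u ∈ Λ ∧ ∀ y ∈ T, 6 * δ < dist ((δ : ℂ) * hexCenter u) y} va z)) := by
  have hδL' : 8 * δ ≤ L := by linarith
  have hδρ : 8 * δ ≤ ρ := by linarith
  set Λ' := (Λ.filter fun z => PathIn hexGraph {u : HexVertex | u ∈ Λ ∧ ∀ y ∈ T, 6 * δ < dist ((δ : ℂ) * hexCenter u) y} va z) with hΛ'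
  -- hubs
  obtain ⟨z₀, hz₀⟩ := exists_vertex_dist_le hδ (p₀ + (L : ℂ) * Complex.I)
  obtain ⟨z₁, hz₁⟩ := exists_vertex_dist_le hδ (p₁ + (L : ℂ) * Complex.I)
  -- paths to the hubs
  have hlow₀ : ∀ {v : HexVertex}, dist ((δ : ℂ) * hexCenter v) p₀ ≤ L / 8 → v ∈ Λ →
      ∀ {z : HexVertex}, dist ((δ : ℂ) * hexCenter z) (p₀ + (L : ℂ) * Complex.I) ≤ δ →
      PathIn hexGraph {u : HexVertex | u ∈ Λ ∧ ∀ y ∈ T, 6 * δ < dist ((δ : ℂ) * hexCenter u) y} v z := fun hv hvΛ _ hz =>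
    pathIn_deepSet_of_low hδ hδL' hLρ hrow₀ hTfar₀ hH₀ hv hvΛ hz
  have hlow₁ : ∀ {v : HexVertex}, dist ((δ : ℂ) * hexCenter v) p₁ ≤ L / 8 → v ∈ Λ →
      ∀ {z : HexVertex}, dist ((δ : ℂ) * hexCenter z) (p₁ + (L : ℂ) * Complex.I) ≤ δ →
      PathIn hexGraph {u : HexVertex | u ∈ Λ ∧ ∀ y ∈ T, 6 * δ < dist ((δ : ℂ) * hexCenter u) y} v z := fun hv hvΛ _ hz =>
    pathIn_deepSet_of_low hδ hδL' hLρ hrow₁ hTfar₁ hH₁ hv hvΛ hz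
  have hva_z₀ : PathIn hexGraph {u : HexVertex | u ∈ Λ ∧ ∀ y ∈ T, 6 * δ < dist ((δ : ℂ) * hexCenter u) y} va z₀ := hlow₀ hva hvaΛ hz₀
  have hva_vb : PathIn hexGraph {u : HexVertex | u ∈ Λ ∧ ∀ y ∈ T, 6 * δ < dist ((δ : ℂ) * hexCenter u) y} va vb := (hlink z₁ hz₁).trans (hlow₁ hvb hvbΛ hz₁).symm
  have hvaΛ' : va ∈ Λ' := mem_subFamily_iff.2 (PathIn.refl hva_z₀.left_mem)
  have hvbΛ' : vb ∈ Λ' := mem_subFamily_iff.2 hva_vb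
  have hsubΛ : Λ' ⊆ Λ := subFamily_subset
  have huaΛ' : ua ∉ Λ' := fun h => huaΛ (hsubΛ h)
  have hubΛ' : ub ∉ Λ' := fun h => hubΛ (hsubΛ h)
  refine ⟨hsubΛ, simplyConnected_subFamily hδ hδρ hflat₁ hΛM hrow₁ hTesc hsc,
    preconnected_subFamily, ?_, ?_, ?_, ?_, ?_, ?_, ?_⟩
  · rw [hea]; exact (mem_hexDomainBoundary_of_adj hvaΛ' huaΛ' hadja.symm).2
  · rw [heb]; exact (mem_hexDomainBoundary_of_adj hvbΛ' hubΛ' hadjb.symm).2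
  · -- a walk `a → b` inside `Λ'`
    have hpath : PathIn hexGraph (↑Λ' : Set HexVertex) va vb :=
      pathIn_of_forall_reachable hva_vb fun u hu => Finset.mem_coe.2 (mem_subFamily_iff.2 hu)
    have hne : s(va, ua) ≠ s(vb, ub) := by
      rw [Sym2.eq_swap, ← hea, Sym2.eq_swap, ← heb]; exact hab
    rw [hea, heb, Sym2.eq_swap (a := ua), Sym2.eq_swap (a := ub)]
    exact nonempty_hexMidEdgeSAW_of_pathIn hvaΛ' huaΛ' hubΛ' hadja.symm hne hpath
  · exact fun v hv => center_mem_of_mem_subFamily hδ.le hΛM hTdiff hv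
  · intro v hv
    have hv' : dist ((δ : ℂ) * hexCenter v) p₀ ≤ L / 8 := (mem_ball.1 hv).le
    have hvρ : (δ : ℂ) * hexCenter v ∈ ball p₀ ρ := mem_ball.2 (by linarith [mem_ball.1 hv])
    constructor
    · exact fun h => (hrow₀ v hvρ).1 (hsubΛ h)
    · intro h
      exact mem_subFamily_iff.2 (hva_z₀.trans (hlow₀ hv' ((hrow₀ v hvρ).2 h) hz₀).symm)
  · intro v hv
    have hv' : dist ((δ : ℂ) * hexCenter v) p₁ ≤ L / 8 := (mem_ball.1 hv).le
    have hvρ : (δ : ℂ) * hexCenter v ∈ ball p₁ ρ := mem_ball.2 (by linarith [mem_ball.1 hv])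
    constructor
    · exact fun h => (hrow₁ v hvρ).1 (hsubΛ h)
    · intro h
      exact mem_subFamily_iff.2 ((hlink z₁ hz₁).trans (hlow₁ hv' ((hrow₁ v hvρ).2 h) hz₁).symm)
  · exact fun z hz => mem_subFamily_iff.2 (hlow₀ hva hvaΛ hz)

/-! ### Registry form -/

/-- **Registered sub-goal `stub_twoPieceAdmIdentification_clauses`** (crux item
stmt-CriticalPhenomena-14005, line `bridge-gate-renewal`, stub `stub_twoPieceAdmIdentification`):
registry form of `subFamily_clauses` — the clauses of the sub-family at a good mesh.
[cite: DuminilCopinSmirnov2012, §2 (domains) and §4 (before Conjecture 1)] -/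
theorem stub_twoPieceAdmIdentification_clauses :
    ∀ (M M' : Set ℂ) (p₀ p₁ : ℂ) (ρ L δ : ℝ) (Λ : Finset HexVertex) (m₀ m₁ : ℤ)
      (a b : Sym2 HexVertex) (T : Set ℂ) (ua va ub vb : HexVertex),
      0 < δ → 16 * δ ≤ L → 4 * L ≤ ρ →
      M ∩ ball p₁ ρ = {z : ℂ | p₁.im < z.im} ∩ ball p₁ ρ →
      (∀ v ∈ Λ, (δ : ℂ) * hexCenter v ∈ M) →
      (∀ v : HexVertex, (δ : ℂ) * hexCenter v ∈ ball p₀ ρ → (v ∈ Λ ↔ m₀ ≤ v.1 1)) →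
      (∀ v : HexVertex, (δ : ℂ) * hexCenter v ∈ ball p₁ ρ → (v ∈ Λ ↔ m₁ ≤ v.1 1)) →
      hexDomainSimplyConnected Λ →
      a = s(ua, va) → va ∈ Λ → ua ∉ Λ → hexGraph.Adj ua va →
      b = s(ub, vb) → vb ∈ Λ → ub ∉ Λ → hexGraph.Adj ub vb → a ≠ b →
      (∀ y ∈ T, 4 * L ≤ dist y p₀) → (∀ y ∈ T, 4 * L ≤ dist y p₁) → M \ M' ⊆ T →
      (∀ y ∈ T, ∃ Ty ⊆ T, IsPreconnected Ty ∧ y ∈ Ty ∧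
        ∃ q ∈ Ty, q.im = p₁.im ∧ dist q p₁ < ρ / 4) →
      dist ((δ : ℂ) * hexCenter va) p₀ ≤ L / 8 → dist ((δ : ℂ) * hexCenter vb) p₁ ≤ L / 8 →
      ((m₀ : ℝ) + 1 / 3) * (δ * (Real.sqrt 3 / 2)) ≤ p₀.im + L / 2 →
      ((m₁ : ℝ) + 1 / 3) * (δ * (Real.sqrt 3 / 2)) ≤ p₁.im + L / 2 →
      (∀ z : HexVertex, dist ((δ : ℂ) * hexCenter z) (p₁ + (L : ℂ) * Complex.I) ≤ δ →
        PathIn hexGraph {u : HexVertex | u ∈ Λ ∧ ∀ y ∈ T, 6 * δ < dist ((δ : ℂ) * hexCenter u) y} va z) →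
      (Λ.filter fun z => PathIn hexGraph {u : HexVertex | u ∈ Λ ∧ ∀ y ∈ T, 6 * δ < dist ((δ : ℂ) * hexCenter u) y} va z) ⊆ Λ ∧
      hexDomainSimplyConnected (Λ.filter fun z => PathIn hexGraph {u : HexVertex | u ∈ Λ ∧ ∀ y ∈ T, 6 * δ < dist ((δ : ℂ) * hexCenter u) y} va z) ∧
      (hexGraph.induce (↑(Λ.filter fun z => PathIn hexGraph {u : HexVertex | u ∈ Λ ∧ ∀ y ∈ T, 6 * δ < dist ((δ : ℂ) * hexCenter u) y} va z) : Set HexVertex)).Preconnected ∧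
      a ∈ hexDomainBoundary (Λ.filter fun z => PathIn hexGraph {u : HexVertex | u ∈ Λ ∧ ∀ y ∈ T, 6 * δ < dist ((δ : ℂ) * hexCenter u) y} va z) ∧
      b ∈ hexDomainBoundary (Λ.filter fun z => PathIn hexGraph {u : HexVertex | u ∈ Λ ∧ ∀ y ∈ T, 6 * δ < dist ((δ : ℂ) * hexCenter u) y} va z) ∧
      Nonempty (HexMidEdgeSAW (Λ.filter fun z => PathIn hexGraph {u : HexVertex | u ∈ Λ ∧ ∀ y ∈ T, 6 * δ < dist ((δ : ℂ) * hexCenter u) y} va z) a b) ∧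
      (∀ v ∈ (Λ.filter fun z => PathIn hexGraph {u : HexVertex | u ∈ Λ ∧ ∀ y ∈ T, 6 * δ < dist ((δ : ℂ) * hexCenter u) y} va z), (δ : ℂ) * hexCenter v ∈ M') ∧
      (∀ v : HexVertex, (δ : ℂ) * hexCenter v ∈ ball p₀ (L / 8) → (v ∈ (Λ.filter fun z => PathIn hexGraph {u : HexVertex | u ∈ Λ ∧ ∀ y ∈ T, 6 * δ < dist ((δ : ℂ) * hexCenter u) y} va z) ↔ m₀ ≤ v.1 1)) ∧
      (∀ v : HexVertex, (δ : ℂ) * hexCenter v ∈ ball p₁ (L / 8) → (v ∈ (Λ.filter fun z => PathIn hexGraph {u : HexVertex | u ∈ Λ ∧ ∀ y ∈ T, 6 * δ < dist ((δ : ℂ) * hexCenter u) y} va z) ↔ m₁ ≤ v.1 1)) ∧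
      (∀ z : HexVertex, dist ((δ : ℂ) * hexCenter z) (p₀ + (L : ℂ) * Complex.I) ≤ δ → z ∈ (Λ.filter fun z => PathIn hexGraph {u : HexVertex | u ∈ Λ ∧ ∀ y ∈ T, 6 * δ < dist ((δ : ℂ) * hexCenter u) y} va z)) :=
  fun _ _ _ _ _ _ _ _ _ _ _ _ _ _ _ _ _ hδ hδL hLρ hflat₁ hΛM hrow₀ hrow₁ hsc hea hvaΛ huaΛ hadja heb
      hvbΛ hubΛ hadjb hab hTfar₀ hTfar₁ hTdiff hTesc hva hvb hH₀ hH₁ hlink =>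
    subFamily_clauses hδ hδL hLρ hflat₁ hΛM hrow₀ hrow₁ hsc hea hvaΛ huaΛ hadja heb hvbΛ hubΛ hadjb
      hab hTfar₀ hTfar₁ hTdiff hTesc hva hvb hH₀ hH₁ hlink

end Summit.CriticalPhenomena.SAWScalingLimit.Theorems.ObservableToSLER.TwoPiece

end
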